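import Literature.NumberTheory.EllipticCurves.GrossPointsThetaNormCompatible
import Literature.NumberTheory.EllipticCurves.NonEisensteinPrimeOfSurjective
import Mathlib.NumberTheory.Padics.Hensel
import HarnessLib

/-!
# Stub `stub_normCompatible` of line «birth», crux `DerivedHeightCap` (stmt-BirchSwinnertonDyer-18438, route DefiniteTheta):
# the theta elements of an admissible definite datum are norm-compatible at the unit root — PROVED

Route-independent `Theorems` file (cell `b2b-bsdres`, seat `b2b-bsdres-x10b`, gen 43; landed while working the Gross-point
tower files of the series «defmu / supersingular theta elements»).
HONEST FRAMING: prove what is provable now; no claim beyond stated classes. Nothing about any curve is asserted and NO summit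
statement is proved here; BSD is not proved by any of this. What IS proved: the registered stub `stub_normCompatible` of the
skeleton `Cruxes/DerivedHeightCap/Lines/birth.lean` (planner-skel, 2026-08-17), VERBATIM.

The skeleton's docstring asked for (i) `T(p)φ = a_p φ` from `eigenLattice … = ℤ ∙ φ` (definitional: `Brandt.mem_eigenLattice_iff`
at the prime `p ∤ N⁺N⁻ = N_V`, good reduction), (ii) the unit root of `x² − a_p x + p` from `p ∤ a_p` (Hensel's lemma in `ℤ_p`,
Mathlib `hensels_lemma`: `‖F(a_p)‖ = ‖p‖ < 1 = ‖F'(a_p)‖² = ‖a_p‖²`; `exists_unitRoot_of_not_dvd`) so that `padicUnitRoot_spec`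
applies, (iii) `IsImaginaryQuadratic K` = `finrank ℚ K = 2 ∧ IsTotallyComplex K`; and flagged the non-square-free `N⁺` allowed by the
datum as the risk ("the tree's fact does not [cover it]"). Since 2026-08-28 the tree PROVES Bertolini–Darmon's Prop. 2.7 from the
norm relations with NO square-freeness hypothesis (`GrossPointTowerNormCompat.isNormCompatible`, file
`GrossPointsThetaNormCompatible.lean`: `K` imaginary quadratic, `p ∤ N⁺N⁻`, `T(p)φ = aφ`, `α² − aα + p = 0`), so the stub closes
for every admissible datum. Of the datum only `p` good, `p ∤ a_p`, `[K:ℚ] = 2` totally complex, `N_V = N⁺N⁻` and the eigen-line are used.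

## References

* [BertoliniDarmon1996] M. Bertolini, H. Darmon, Invent. Math. 126 (1996), §2.4 (5), Prop. 2.7, Cor. 2.8.
* [BertoliniDarmon2005] M. Bertolini, H. Darmon, Ann. of Math. 162 (2005), §1.1 ("`α_p ∈ ℤ_p` the unique root of
  `x² − a_p x + p` which is a `p`-adic unit").
-/

noncomputable section

open scoped Matrix

-- D-0017: single-problem summit, the namespace repeats the problem name by design.
set_option linter.dupNamespace false

namespace Summit.BirchSwinnertonDyer.BirchSwinnertonDyer.Theorems.DerivedHeightCapNormCompatible

open Literature.NumberTheory.EllipticCurves Literature.NumberTheory.Automorphic Polynomial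

/-- **The `p`-adic unit root of `x² − a x + p` exists when `p ∤ a`** (Hensel's lemma in `ℤ_p` at the approximate root `a`:
`F(a) = p`, `F'(a) = a` a unit; the root `z ≡ a (mod p)` is a unit). [cite: BertoliniDarmon2005, §1.1] -/
theorem exists_unitRoot_of_not_dvd (p : ℕ) [hp : Fact p.Prime] (a : ℤ) (ha : ¬ (p : ℤ) ∣ a) :
    ∃ u : ℤ_[p]ˣ, (u : ℤ_[p]) ^ 2 - a * u + p = 0 := by
  let F : Polynomial ℤ := X ^ 2 - C a * X + C (p : ℤ)
  have hF : ∀ z : ℤ_[p], aeval z F = z ^ 2 - (a : ℤ_[p]) * z + p := fun z => by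
    simp [F]
  have h2 : ∀ z : ℤ_[p], aeval z (2 : Polynomial ℤ) = (2 : ℤ_[p]) := fun z => by
    rw [show (2 : Polynomial ℤ) = C 2 from rfl, aeval_C]; simp
  have hF' : ∀ z : ℤ_[p], aeval z (derivative F) = 2 * z - (a : ℤ_[p]) := fun z => by
    simp [F, derivative_natCast, h2 z]
  have hna : ‖(a : ℤ_[p])‖ = 1 :=
    le_antisymm (PadicInt.norm_le_one _) (not_lt.mp fun h => ha ((PadicInt.norm_int_lt_one_iff_dvd a).mp h))
  have hp1 : ‖(p : ℤ_[p])‖ < 1 := by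
    rw [PadicInt.norm_p]
    exact inv_lt_one_of_one_lt₀ (by exact_mod_cast hp.out.one_lt)
  have hFa : aeval (a : ℤ_[p]) F = p := by rw [hF]; ring
  have hF'a : aeval (a : ℤ_[p]) (derivative F) = a := by rw [hF']; ring
  have hnorm : ‖aeval (a : ℤ_[p]) F‖ < ‖aeval (a : ℤ_[p]) (derivative F)‖ ^ 2 := by
    rw [hFa, hF'a, hna, one_pow]; exact hp1
  obtain ⟨z, hz, hza, -, -⟩ := hensels_lemma hnorm
  rw [hF'a, hna] at hza
  -- `z` is a unit: `‖a‖ ≤ max ‖a − z‖ ‖z‖`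
  have hz1 : ‖z‖ = 1 := by
    refine le_antisymm (PadicInt.norm_le_one _) (not_lt.mp fun hlt => ?_)
    have h1 : ‖(a : ℤ_[p])‖ ≤ max ‖(a : ℤ_[p]) - z‖ ‖z‖ := by
      have := PadicInt.nonarchimedean ((a : ℤ_[p]) - z) z
      rwa [sub_add_cancel] at this
    rw [hna, ← norm_neg ((a : ℤ_[p]) - z), neg_sub] at h1
    exact absurd h1 (not_le.mpr (max_lt hza hlt))
  refine ⟨(PadicInt.isUnit_iff.mpr hz1).unit, ?_⟩
  rw [IsUnit.unit_spec, ← hF]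
  exact hz

/-- **Stub `stub_normCompatible` (line «birth» of crux `DerivedHeightCap`, stmt-BirchSwinnertonDyer-18438) — PROVED, signature
VERBATIM**: at every admissible definite datum the Bertolini–Darmon theta elements of the tower of Gross points are norm-compatible
at the unit root `α_p = padicUnitRoot p (a_p)`. Proof: `GrossPointTowerNormCompat.isNormCompatible` (BD96 Prop. 2.7, proved in the tree
without square-freeness) with (i) `T(p)φ = a_pφ` from the eigen-line (`p ∤ N⁺N⁻ = N_V` by good reduction), (ii) the Hensel unit
root (`exists_unitRoot_of_not_dvd`, `padicUnitRoot_spec`; `a_p = V.LFunction p = V.frobeniusTrace p`), (iii) `IsImaginaryQuadratic K`.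
[cite: BertoliniDarmon1996, Prop. 2.7 and Cor. 2.8] [cite: BertoliniDarmon2005, §1.1] -/
theorem stub_normCompatible :
    ∀ (V : WeierstrassCurve ℚ) [V.IsElliptic] [V.IsGloballyMinimal] (p : ℕ) [Fact p.Prime] (Nplus Nminus : ℕ) (K : Type) [Field K] [NumberField K] (S : Literature.NumberTheory.Automorphic.Brandt.XiSetup Nplus Nminus) [Fintype (Literature.NumberTheory.Automorphic.Brandt.ClassSet S.O)] (T : Literature.NumberTheory.EllipticCurves.GrossPointTower K S p) (φ : Literature.NumberTheory.Automorphic.Brandt.ClassSet S.O → ℤ), ((7 ≤ p ∧ V.HasGoodReductionAtPrime p ∧ ¬ (p : ℤ) ∣ V.frobeniusTrace p ∧ ¬ (p : ℤ) ∣ (V.frobeniusTrace p) ^ 2 - 1 ∧ V.HasSurjectiveModNGaloisRep p ∧ (∀ q : ℕ, q.Prime → q ∣ V.conductorNorm ℤ → ¬ (p : ℤ) ∣ (q : ℤ) ^ 2 - 1) ∧ ¬ p ∣ NumberField.classNumber K) ∧ (Module.finrank ℚ K = 2 ∧ NumberField.IsTotallyComplex K ∧ NumberField.discr K < -4 ∧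 Int.gcd (NumberField.discr K) (V.conductorNorm ℤ * p) = 1) ∧ (V.conductorNorm ℤ = Nplus * Nminus ∧ Nat.Coprime Nplus Nminus ∧ Odd Nminus.primeFactors.card ∧ (∀ q : ℕ, q.Prime → q ∣ Nplus → ((Ideal.span {(q : ℤ)}).primesOver (NumberField.RingOfIntegers K)).ncard = 2) ∧ (∀ q : ℕ, q.Prime → q ∣ Nminus → ((Ideal.span {(q : ℤ)}).primesOver (NumberField.RingOfIntegers K)).ncard = 1)) ∧ (φ ≠ 0 ∧ Literature.NumberTheory.Automorphic.Brandt.eigenLattice (Nplus * Nminus) (Literature.NumberTheory.Automorphic.Brandt.matrix S.O) (fun n => V.LFunction n) = Submodule.span ℤ {φ})) → T.IsNormCompatible p φ (Literature.NumberTheory.EllipticCurves.padicUnitRoot p (V.LFunction p)) := by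
  intro V _ _ p _ Nplus Nminus K _ _ S _ T φ h
  obtain ⟨⟨-, hgood, hap, -, -, -, -⟩, ⟨h2, htc, -, -⟩, ⟨hN, -, -, -, -⟩, ⟨-, hφ⟩⟩ := h
  have hK : IsImaginaryQuadratic K := ⟨h2, htc⟩
  have hpN : ¬ p ∣ Nplus * Nminus := by
    rw [← hN]
    exact not_dvd_conductorNorm_of_hasGoodReductionAtPrime V hgood
  have hmem : φ ∈ Brandt.eigenLattice (Nplus * Nminus) (Brandt.matrix S.O) (fun n => V.LFunction n) := by
    rw [hφ]
    exact Submodule.mem_span_singleton_self φ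
  have heig : Brandt.matrix S.O p *ᵥ φ = (V.LFunction p) • φ := (Brandt.mem_eigenLattice_iff.mp hmem) p Fact.out hpN
  have hap' : ¬ (p : ℤ) ∣ V.LFunction p := by
    rw [WeierstrassCurve.LFunction_apply_prime_eq_frobeniusTrace V p hgood]
    exact hap
  have hα := padicUnitRoot_spec p (exists_unitRoot_of_not_dvd p (V.LFunction p) hap')
  exact GrossPointTowerNormCompat.isNormCompatible hK hpN φ (V.LFunction p) heig _ hα T

end Summit.BirchSwinnertonDyer.BirchSwinnertonDyer.Theorems.DerivedHeightCapNormCompatible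

end
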